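import Mathlib.Probability.Distributions.Gaussian.Real
import Mathlib.Probability.Moments.Basic
import HarnessLib

/-!
# Crux `BirComplexStableXYR`, line `fat-gaussian-defect-calculus`: stub C2a `stub_gaussianRealTail`

Registered stub (lead c8, wave 11, skeleton `Cruxes/BirComplexStableXYR/Lines/fat_gaussian_defect_calculus.lean`),
helper (`--supports`) for the crux `Summit.HubbardSuperconductivity.HubbardSuperconductivity.Theses.BalabanIR.BirComplexStableXYR`:
**the two-sided tail of a real centred Gaussian.**

**Statement.** For the real centred Gaussian `gaussianReal 0 v` (`v : ℝ≥0`) and `t ≥ 0`,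
`P(|X| ≥ t) ≤ 2·exp(−t²/(2v))`, stated in `ℝ≥0∞` with `ENNReal.ofReal` (the generic large-field rarity
estimate of the line).

**Proof.** Pure Mathlib.  One-sided tails by Chernoff: `measure_ge_le_exp_mul_mgf` (resp.
`measure_le_le_exp_mul_mgf`) for `X = id` under the probability measure `gaussianReal 0 v`, with the Gaussian
moment generating function `mgf_id_gaussianReal : E e^{sX} = e^{v s²/2}` at `s = t/v` (resp. `s = −t/v`), gives
`P(X ≥ t) ≤ e^{−t²/v + t²/(2v)} = e^{−t²/(2v)}` and the same for `P(X ≤ −t)`.  The exponent identity is uniform in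
`v`: for `v = 0` Lean's `t/0 = 0` makes both sides `e^0 = 1` (and indeed `gaussianReal 0 0 = δ₀` has tails `≤ 1`).
Finally `{t ≤ |x|} ⊆ {t ≤ x} ∪ {x ≤ −t}`, subadditivity (`measureReal_union_le`), and the passage
`μ s = ofReal (μ.real s)` (`ofReal_measureReal`, finite measure) with `ENNReal.ofReal_le_ofReal`.
Elementary given Mathlib; no definition and no named fact is introduced; sorry-free. [folklore]
-/

set_option linter.dupNamespace false -- `Summit.<S>.<S>.Theorems…` repeats the summit name (D-0017 layout)

namespace Summit.HubbardSuperconductivity.HubbardSuperconductivity.Theorems.FSUnfolding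

open MeasureTheory ProbabilityTheory Real
open scoped ENNReal NNReal

/-- **Chernoff exponent for the centred Gaussian:** at `s = t/v`, `−s·t + (0·s + v s²/2) = −t²/(2v)`; uniform in
`v : ℝ≥0` (for `v = 0` both sides vanish since `t/0 = 0` in Lean). [folklore] -/
theorem hsc_gaussTail_exponent (v : ℝ≥0) (t : ℝ) :
    -(t / (v : ℝ)) * t + (0 * (t / (v : ℝ)) + (v : ℝ) * (t / (v : ℝ)) ^ 2 / 2) = -(t ^ 2 / (2 * (v : ℝ))) := by
  rcases eq_or_ne v 0 with hv | hv
  · subst hv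
    simp
  · have hv' : (v : ℝ) ≠ 0 := NNReal.coe_ne_zero.mpr hv
    field_simp
    ring

/-- **Upper tail of `𝒩(0, v)`:** `P(X ≥ t) ≤ e^{−t²/(2v)}` for `t ≥ 0` (Chernoff `measure_ge_le_exp_mul_mgf` at
`s = t/v ≥ 0` with `mgf_id_gaussianReal`). [folklore] -/
theorem hsc_gaussTail_real_Ici_le (v : ℝ≥0) {t : ℝ} (ht : 0 ≤ t) :
    (gaussianReal 0 v).real {x : ℝ | t ≤ x} ≤ exp (-(t ^ 2 / (2 * (v : ℝ)))) := by
  have hs : 0 ≤ t / (v : ℝ) := div_nonneg ht v.coe_nonneg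
  have h := measure_ge_le_exp_mul_mgf (μ := gaussianReal 0 v) (X := id) t hs
    (integrable_exp_mul_gaussianReal (μ := 0) (v := v) _)
  rw [congrFun mgf_id_gaussianReal (t / (v : ℝ)), ← Real.exp_add, hsc_gaussTail_exponent] at h
  exact h

/-- **Lower tail of `𝒩(0, v)`:** `P(X ≤ −t) ≤ e^{−t²/(2v)}` for `t ≥ 0` (Chernoff `measure_le_le_exp_mul_mgf` at
`s = −t/v ≤ 0` with `mgf_id_gaussianReal`). [folklore] -/
theorem hsc_gaussTail_real_Iic_le (v : ℝ≥0) {t : ℝ} (ht : 0 ≤ t) :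
    (gaussianReal 0 v).real {x : ℝ | x ≤ -t} ≤ exp (-(t ^ 2 / (2 * (v : ℝ)))) := by
  have hs : -(t / (v : ℝ)) ≤ 0 := neg_nonpos.mpr (div_nonneg ht v.coe_nonneg)
  have h := measure_le_le_exp_mul_mgf (μ := gaussianReal 0 v) (X := id) (-t) hs
    (integrable_exp_mul_gaussianReal (μ := 0) (v := v) _)
  rw [congrFun mgf_id_gaussianReal (-(t / (v : ℝ))), ← Real.exp_add] at h
  have heq : -(-(t / (v : ℝ))) * -t + (0 * (-(t / (v : ℝ))) + (v : ℝ) * (-(t / (v : ℝ))) ^ 2 / 2) =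
      -(t ^ 2 / (2 * (v : ℝ))) := by
    rw [← hsc_gaussTail_exponent v t]
    ring
  rw [heq] at h
  exact h

/-- **Two-sided tail of `𝒩(0, v)` in `ℝ`:** `P(|X| ≥ t) ≤ 2e^{−t²/(2v)}` for `t ≥ 0`
(`{t ≤ |x|} ⊆ {t ≤ x} ∪ {x ≤ −t}` and subadditivity). [folklore] -/
theorem hsc_gaussTail_real_abs_ge_le (v : ℝ≥0) {t : ℝ} (ht : 0 ≤ t) :
    (gaussianReal 0 v).real {x : ℝ | t ≤ |x|} ≤ 2 * exp (-(t ^ 2 / (2 * (v : ℝ)))) := by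
  have hsub : {x : ℝ | t ≤ |x|} ⊆ {x : ℝ | t ≤ x} ∪ {x : ℝ | x ≤ -t} := by
    intro x hx
    simp only [Set.mem_setOf_eq, Set.mem_union] at hx ⊢
    rcases le_or_gt 0 x with h0 | h0
    · left; rwa [abs_of_nonneg h0] at hx
    · right; rw [abs_of_neg h0] at hx; linarith
  calc (gaussianReal 0 v).real {x : ℝ | t ≤ |x|}
      ≤ (gaussianReal 0 v).real ({x : ℝ | t ≤ x} ∪ {x : ℝ | x ≤ -t}) :=
        measureReal_mono hsub (measure_ne_top _ _)
    _ ≤ (gaussianReal 0 v).real {x : ℝ | t ≤ x} + (gaussianReal 0 v).real {x : ℝ | x ≤ -t} :=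
        measureReal_union_le _ _
    _ ≤ exp (-(t ^ 2 / (2 * (v : ℝ)))) + exp (-(t ^ 2 / (2 * (v : ℝ)))) :=
        add_le_add (hsc_gaussTail_real_Ici_le v ht) (hsc_gaussTail_real_Iic_le v ht)
    _ = 2 * exp (-(t ^ 2 / (2 * (v : ℝ)))) := by ring

/-- **stub C2a (S/M, generic): the Gaussian tail.**  For the real centred Gaussian of variance `v` and `t ≥ 0`,
`P(|X| ≥ t) ≤ 2e^{−t²/(2v)}` (Chernoff with `mgf_gaussianReal`, both signs; for `v = 0` the law is `δ₀`).
[folklore] -/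
theorem stub_gaussianRealTail :
    ∀ (v : NNReal) (t : ℝ), 0 ≤ t →
      (ProbabilityTheory.gaussianReal 0 v) {x : ℝ | t ≤ |x|} ≤
        ENNReal.ofReal (2 * Real.exp (-(t ^ 2 / (2 * (v : ℝ))))) := by
  intro v t ht
  rw [← ofReal_measureReal (measure_ne_top (gaussianReal 0 v) {x : ℝ | t ≤ |x|})]
  exact ENNReal.ofReal_le_ofReal (hsc_gaussTail_real_abs_ge_le v ht)

end Summit.HubbardSuperconductivity.HubbardSuperconductivity.Theorems.FSUnfolding
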